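import Summits.ResolutionOfSingularities.ResolutionOfSingularities.Theorems.PurelyInseparableDim4ResConeTwoSlotPowerConeTailSigma
import Summits.ResolutionOfSingularities.ResolutionOfSingularities.Theorems.PurelyInseparableDim4ResConePureCornerTail
import Summits.ResolutionOfSingularities.ResolutionOfSingularities.Theorems.PurelyInseparableDim4Equimultiple
import HarnessLib
import HarnessLib.Audit.Tags

/-!
# Purely inseparable four-folds — POWER-CONE TAILS, THE σ-DIAGONAL (n, n, n): a three-letter power-cone tail in T-normal form started at a
# letter change is impossible — every prime (cell `res-dim4-pi`, K2(p) lane, B rows, row B-LF (iii-b) «K24a-PRIME-σ», the DIAGONAL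
# `w = n` with three rotating letters; seat res-dim4-p-1 g7)

[OURS · counted 0 · cell `res-dim4-pi` · K2(p) lane (holder res-dim4-p-12 g5).  COMPOSITION over the lane's tree modules, CITED BY NAME:
res-dim4-p-7 g6's LEDGER-FREE core step `ResCone.core_step_sigma` (δ3, p722052) and Tschirnhaus row `coeff_tschRow_step_zero_eq_zero_sigma`
(δ1), res-dim4-typ-1 g5's transport (`SwapTransport.step_cases_of_slot_sigma`, `pure_step_of_straight_slot_sigma`, E2 re-framing
`FrameChange.exists_reframed_chain` of res-dim4-p-11), res-dim4-p-1 g6's entry frame `FrameChange.twoSlot_entry_frame_sigma` (E1), and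
res-dim4-p-5 g6's hypothesis-free drift theorem `ResCone.no_pureCorner_tail`.]  Nothing here proves K2(p) for any `p`, any TAIL(p, d, 3),
`NoAboveFloorTrap p p` or resolution of singularities in dimension ≥ 4 / characteristic `p` — NOT proved.  AI kernel work, weaker than
expert review.  A statement about OUR frame's hypothetical `Step0 p` chains.

SETTING.  σ-DIAGONAL: boundary `n·x + n·y + n·v` (`n ≥ 1`), free carrier `z`, order `p + n`, `2n + d = p`, `d ≥ 2`, `e_G = 3` at every time.
In class (i) (`(n, n) + w`, `w ≠ n`; composition p722900, RAW link p723209) the weights pin the charts to two slots; on the diagonal all three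
weighted letters may be charted (ROTATION).  KEY POINT: no three-slot game is needed — p-7's LEDGER-FREE core step `core_step_sigma` (δ3) sees
the two non-chart letters only through their weights, and `n·x + n·y + n·v = n·j + n·i + n·u` for EVERY labelling.  Hence:
* §1 `core_step_diag_sigma` / **`core_play_diag_sigma`** — the core package travels along ANY guarded-pure play on the three letters started at
  a letter change; in particular the play is PURE AT EVERY TIME (unguarded).
* §2 `step_cases_of_diag_sigma`, `pure_step_of_straight_diag_sigma`, **`framed_play_diag_sigma`** — typ-1's T2′ `framed_play_slot_sigma` with
  three chart letters (charts only known to avoid `z`): the E2-re-framed real tail is a witnessed play with constant weights, order, isolation,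
  `x^r ∣ F`, `e_G = 3`, pure at every straight time, and the entry readings survive the cleaning.
* §3 **`no_threeLetter_powerCone_tail_diag_sigma`** — a σ-diagonal power-cone tail in T-normal form (charts avoid `z`, `z ∉ exc₀`, clean start,
  power-cone form `a₀·ℓ^d` with `ℓ z ≠ 0` at time `0`, letter change `j 0 ≠ j 1`) is impossible: E1 ∘ §2 ∘ §1 make the framed chain pure-corner
  at every time; re-witnessed with zero translations (`Equimultiple.isEquimultiplePoint_iff_le_ordZero_step`) it is an isolated witnessed
  `Step0 p` chain with `b ≡ 0`, which `ResCone.no_pureCorner_tail` forbids (any rotation pattern).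
The RAW link (diagonal σ-weights on SOME three letters at every late time + T-sector witness ⊢ False) is the sequel file.
[cite: CossartJannsenSaito2020, Thm. 3.14, Lemma 13.2] [cite: Hauser2010, §§F–G] [cite: HauserPerlega2019PRIMS, §2 (transform D′ of D)]
bears_on: LADDER-RESOLUTION:D157-DOOR2 (res-dim4-pi · K2(p) B-LF (iii-b) K24a-PRIME-σ DIAGONAL).  Supports stmt-ResolutionOfSingularities-16155 (helper).
-/

set_option linter.dupNamespace false -- mandated namespace of this single-conjunct summit

noncomputable section

namespace Summit.ResolutionOfSingularities.ResolutionOfSingularities.Theorems.PIDim4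
namespace ResCone

open MvPolynomial Finset
open Literature.AlgebraicGeometry.Resolution
open Literature.AlgebraicGeometry.Resolution.CentreBlowup
open Literature.AlgebraicGeometry.Resolution.Hauser2010
open Literature.AlgebraicGeometry.Resolution.HauserPerlega2019

variable {K : Type} [Field K] [DecidableEq K]

/-! ## §1 The ledger-free core package along a three-letter pure-corner play -/

section Letters

variable {j i u f : Fin 4} (hji : j ≠ i) (hju : j ≠ u) (hjf : j ≠ f) (hiu : i ≠ u) (hif : i ≠ f) (huf : u ≠ f)
include hji hju hjf hiu hif huf

/-- **One step of the ledger-free core package on the diagonal (chart `j`)**: p-7's `core_step_sigma` at `w = n`, with the Tschirnhaus rows of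
BOTH other letters `i`, `u` dead at the child (δ1 `coeff_tschRow_step_zero_eq_zero_sigma` with `(a, b) = (m, 0)` and `(0, m)`), and the
boundary returned as `s.r`. [OURS · composition] [cite: CossartJannsenSaito2020, Lemma 13.2] -/
theorem core_step_diag_sigma (p : ℕ) [Fact p.Prime] [CharP K p] {n d : ℕ} (hσ : n + n + d = p) (hn : 1 ≤ n) (hd2 : 2 ≤ d)
    {s : State K} (hr : s.r = Finsupp.single j n + Finsupp.single i n + Finsupp.single u n)
    (hdiv : ∀ e ∈ s.F.support, s.r ≤ e) (ho : ordZero s.F = ((p + n : ℕ) : ℕ∞))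
    (ha : coeff (s.r + Finsupp.single f d) s.F ≠ 0)
    (hstraight : ∀ m : Fin 4 →₀ ℕ, m.degree = d → m ≠ Finsupp.single f d → coeff (s.r + m) s.F = 0)
    (htsch : coeff (s.r + (Finsupp.single f (d - 1) + Finsupp.single j 2)) s.F = 0)
    (ho' : ordZero (CentreBlowup.step p Finset.univ j 0 s).F = ((p + n : ℕ) : ℕ∞))
    (he3' : Module.finrank K (resVertex (CentreBlowup.step p Finset.univ j 0 s)) = 3) :
    (CentreBlowup.step p Finset.univ j 0 s).r = s.r ∧
      (∀ e ∈ (CentreBlowup.step p Finset.univ j 0 s).F.support, (CentreBlowup.step p Finset.univ j 0 s).r ≤ e) ∧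
      coeff ((CentreBlowup.step p Finset.univ j 0 s).r + Finsupp.single f d) (CentreBlowup.step p Finset.univ j 0 s).F ≠ 0 ∧
      (∀ m : Fin 4 →₀ ℕ, m.degree = d → m ≠ Finsupp.single f d →
        coeff ((CentreBlowup.step p Finset.univ j 0 s).r + m) (CentreBlowup.step p Finset.univ j 0 s).F = 0) ∧
      (∀ l, (l = i ∨ l = u) → ∀ m, 2 ≤ m →
        coeff ((CentreBlowup.step p Finset.univ j 0 s).r + (Finsupp.single f (d - 1) + Finsupp.single l m))
          (CentreBlowup.step p Finset.univ j 0 s).F = 0) ∧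
      (∀ m, 1 ≤ m → coeff ((CentreBlowup.step p Finset.univ j 0 s).r + (Finsupp.single f (d - 1) + Finsupp.single j m))
        (CentreBlowup.step p Finset.univ j 0 s).F = coeff (s.r + (Finsupp.single f (d - 1) + Finsupp.single j (m + 1))) s.F) := by
  obtain ⟨h1, h2, h3, h4, h6, h7⟩ :=
    core_step_sigma hji hju hjf hiu hif huf p hσ hn hd2 hr hdiv ho ha hstraight htsch ho' he3'
  have hr' : (CentreBlowup.step p Finset.univ j 0 s).r = s.r := by rw [h1, hr]
  have hq : ((p : ℕ) : ℕ∞) ≤ ordAlong Finset.univ s.F := by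
    rw [ordAlong_univ, ho]; exact_mod_cast (by omega : p ≤ p + n)
  refine ⟨hr', h2, h3, h4, ?_, h7⟩
  rintro l (rfl | rfl) m hm
  · exact h6 m hm
  · have h := coeff_tschRow_step_zero_eq_zero_sigma hji hju hjf hiu hif huf p hσ hr hdiv hq (a := 0) (b := m) (by omega)
    rw [Finsupp.single_zero, add_zero] at h
    rw [hr']
    exact h

/-- **THE LEDGER-FREE CORE PACKAGE ALONG A THREE-LETTER PLAY, σ-DIAGONAL (n, n, n), every prime.**  A play `s` with chart word `κ` in the
three weighted letters `{j, i, u}`, GUARDED pure (`resForm (s t) = a·x_f^d`, `a ≠ 0` ⇒ `s (t+1) = step p univ (κ t) 0 (s t)`), of order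
`p + n` and `e_G = 3` at every time, started from the boundary `n·j + n·i + n·u`, `x^r ∣ F`, STRAIGHT with `coeff (r + d·f) ≠ 0`, ONE
Tschirnhaus coefficient `coeff (r + (d−1)·f + 2·κ₀) = 0` and a LETTER CHANGE `κ 0 ≠ κ 1`, carries at every time `t`: the boundary,
`x^r ∣ F`, the `x_f^d`-coefficient, straightness, the Tschirnhaus coefficients `x_f^{d−1}·κ_t^m` (`m ≥ 2`; all of them from time `1`), and the
step IS pure: `s (t+1) = step p univ (κ t) 0 (s t)`.  Proof: induction with `core_step_diag_sigma` in the labelling `(κ t, ·, ·)` — the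
boundary is the same Finsupp for every labelling — exactly as p-7's `core_play_sigma`; a repeated letter uses the shifted row, a new letter the
dead rows of the previous child. [OURS · composition] [cite: CossartJannsenSaito2020, Thm. 3.14, Lemma 13.2] -/
theorem core_play_diag_sigma (p : ℕ) [Fact p.Prime] [CharP K p] {n d : ℕ} (hσ : n + n + d = p) (hn : 1 ≤ n) (hd2 : 2 ≤ d)
    (s : ℕ → State K) (κ : ℕ → Fin 4) (hκ : ∀ t, κ t = j ∨ κ t = i ∨ κ t = u)
    (hstep : ∀ t, (∃ a : K, a ≠ 0 ∧ resForm (s t) = C a * X f ^ d) →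
      s (t + 1) = CentreBlowup.step p Finset.univ (κ t) 0 (s t))
    (hr0 : (s 0).r = Finsupp.single j n + Finsupp.single i n + Finsupp.single u n)
    (hdiv0 : ∀ e ∈ (s 0).F.support, (s 0).r ≤ e)
    (ho : ∀ t, ordZero (s t).F = ((p + n : ℕ) : ℕ∞)) (he3 : ∀ t, Module.finrank K (resVertex (s t)) = 3)
    (ha0 : coeff ((s 0).r + Finsupp.single f d) (s 0).F ≠ 0)
    (hstraight0 : ∀ m : Fin 4 →₀ ℕ, m.degree = d → m ≠ Finsupp.single f d → coeff ((s 0).r + m) (s 0).F = 0)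
    (htsch0 : coeff ((s 0).r + (Finsupp.single f (d - 1) + Finsupp.single (κ 0) 2)) (s 0).F = 0)
    (h01 : κ 0 ≠ κ 1) (t : ℕ) :
    (s t).r = Finsupp.single j n + Finsupp.single i n + Finsupp.single u n ∧ (∀ e ∈ (s t).F.support, (s t).r ≤ e) ∧
      coeff ((s t).r + Finsupp.single f d) (s t).F ≠ 0 ∧
      (∀ m : Fin 4 →₀ ℕ, m.degree = d → m ≠ Finsupp.single f d → coeff ((s t).r + m) (s t).F = 0) ∧
      (∀ m, 2 ≤ m → (1 ≤ t ∨ m = 2) →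
        coeff ((s t).r + (Finsupp.single f (d - 1) + Finsupp.single (κ t) m)) (s t).F = 0) ∧
      s (t + 1) = CentreBlowup.step p Finset.univ (κ t) 0 (s t) := by
  have hguard' : ∀ {S : State K}, S.r = Finsupp.single j n + Finsupp.single i n + Finsupp.single u n →
      ordZero S.F = ((p + n : ℕ) : ℕ∞) → coeff (S.r + Finsupp.single f d) S.F ≠ 0 →
      (∀ m : Fin 4 →₀ ℕ, m.degree = d → m ≠ Finsupp.single f d → coeff (S.r + m) S.F = 0) →
      ∃ a : K, a ≠ 0 ∧ resForm S = C a * X f ^ d := by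
    intro S hrS hoS haS hstS
    have hrdeg : S.r.degree = 2 * n + n := by
      rw [hrS, map_add, map_add, Finsupp.degree_single, Finsupp.degree_single, Finsupp.degree_single]; ring
    exact ⟨_, haS, resForm_eq_C_mul_X_pow_of_readings_sigma hoS (by rw [hrdeg]; omega) rfl hstS⟩
  induction t with
  | zero =>
    refine ⟨hr0, hdiv0, ha0, hstraight0, fun m hm h01' => ?_, hstep 0 (hguard' hr0 (ho 0) ha0 hstraight0)⟩
    rcases h01' with h | rfl
    · omega
    · exact htsch0
  | succ t ih =>
    obtain ⟨hr, hdiv, ha, hst, hT, hs⟩ := ih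
    have htsch : coeff ((s t).r + (Finsupp.single f (d - 1) + Finsupp.single (κ t) 2)) (s t).F = 0 :=
      hT 2 le_rfl (by by_cases h : 1 ≤ t <;> [exact Or.inl h; exact Or.inr rfl])
    have ho' := ho (t + 1)
    have he3' := he3 (t + 1)
    rw [hs] at ho' he3' ⊢
    -- a labelling `(κ t, b, c)` of the three letters
    obtain ⟨b, c, hab, hac, haf, hbc, hbf, hcf, hra, hothers⟩ : ∃ b c : Fin 4, κ t ≠ b ∧ κ t ≠ c ∧ κ t ≠ f ∧ b ≠ c ∧
        b ≠ f ∧ c ≠ f ∧ (s t).r = Finsupp.single (κ t) n + Finsupp.single b n + Finsupp.single c n ∧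
        (∀ l, (l = j ∨ l = i ∨ l = u) → l ≠ κ t → (l = b ∨ l = c)) := by
      rcases hκ t with hk | hk | hk <;> rw [hk]
      · refine ⟨i, u, hji, hju, hjf, hiu, hif, huf, hr, fun l hl hne => ?_⟩
        rcases hl with h | h | h
        · exact absurd h hne
        · exact Or.inl h
        · exact Or.inr h
      · refine ⟨j, u, hji.symm, hiu, hif, hju, hjf, huf, by rw [hr, add_comm (Finsupp.single j n)], fun l hl hne => ?_⟩
        rcases hl with h | h | h
        · exact Or.inl h
        · exact absurd h hne
        · exact Or.inr h
      · refine ⟨j, i, hju.symm, hiu.symm, huf, hji, hjf, hif, by rw [hr]; exact (add_rotate _ _ _).symm, fun l hl hne => ?_⟩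
        rcases hl with h | h | h
        · exact Or.inl h
        · exact Or.inr h
        · exact absurd h hne
    obtain ⟨h1, h2, h3, h4, h6, h7⟩ :=
      core_step_diag_sigma hab hac haf hbc hbf hcf p hσ hn hd2 hra hdiv (ho t) ha hst htsch ho' he3'
    have h1' : (CentreBlowup.step p Finset.univ (κ t) 0 (s t)).r =
        Finsupp.single j n + Finsupp.single i n + Finsupp.single u n := by rw [h1, hr]
    refine ⟨h1', h2, h3, h4, fun m hm _ => ?_, ?_⟩
    · by_cases hk1 : κ (t + 1) = κ t
      · rw [hk1, h7 m (by omega)]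
        have h1t : 1 ≤ t := by
          by_contra h0
          have ht0 : t = 0 := by omega
          subst ht0
          exact h01 hk1.symm
        exact hT (m + 1) (by omega) (Or.inl h1t)
      · exact h6 (κ (t + 1)) (hothers _ (hκ (t + 1)) hk1) m hm
    · have h := hstep (t + 1) (by rw [hs]; exact hguard' h1' ho' h3 h4)
      rw [hs] at h
      exact h

end Letters

/-! ## §2 Transport, diagonal edition: three chart letters (typ-1's T2′ relabelled per step) -/

/-- **A σ-diagonal-KEEPING STEP TRANSLATES NOTHING BUT THE CARRIER** (boundary `n·x + n·y + n·v`, `0 < n`, chart `jr ≠ z`): if the child is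
again a σ-diagonal state for some three letters, then `b` vanishes off `z` and the weights are unchanged (typ-1's `step_cases_of_slot_sigma`
at `w = n`, in the labelling that makes `jr` a slot). [OURS] [cite: HauserPerlega2019PRIMS, §2 (transform D′ of D)] -/
theorem step_cases_of_diag_sigma (p : ℕ) {n : ℕ} (hn : 0 < n) {x y v z : Fin 4} (hxy : x ≠ y) (hxv : x ≠ v) (hxz : x ≠ z)
    (hyv : y ≠ v) (hyz : y ≠ z) (hvz : v ≠ z) {A : State K}
    (hrA : A.r = Finsupp.single x n + Finsupp.single y n + Finsupp.single v n) (ho : ordZero A.F = ((p + n : ℕ) : ℕ∞))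
    {jr : Fin 4} (hjz : jr ≠ z) {b : Fin 4 → K} (hbj : b jr = 0)
    (hrA' : ∃ x' y' v' : Fin 4, x' ≠ y' ∧ x' ≠ v' ∧ y' ≠ v' ∧
      (CentreBlowup.step p Finset.univ jr b A).r = Finsupp.single x' n + Finsupp.single y' n + Finsupp.single v' n) :
    (∀ ℓ, ℓ ≠ z → b ℓ = 0) ∧ (CentreBlowup.step p Finset.univ jr b A).r = A.r := by
  rcases letters_exhaust hxy hxv hxz hyv hyz hvz jr with h | h | h | h
  · exact SwapTransport.step_cases_of_slot_sigma p hn hn hxy hxv hxz hyv hyz hvz hrA ho (Or.inl h) hbj hrA'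
  · exact SwapTransport.step_cases_of_slot_sigma p hn hn hxy hxv hxz hyv hyz hvz hrA ho (Or.inr h) hbj hrA'
  · have hrA2 : A.r = Finsupp.single v n + Finsupp.single x n + Finsupp.single y n := by
      rw [hrA]; exact (add_rotate _ _ _).symm
    exact SwapTransport.step_cases_of_slot_sigma p hn hn hxv.symm hyv.symm hvz hxy hxz hyz hrA2 ho (Or.inl h) hbj hrA'
  · exact absurd h hjz

/-- **PURE STEP EXTRACTION, diagonal edition**: an honest step from a STRAIGHT σ-diagonal state in a chart `jr ≠ z`, whose child is again a
σ-diagonal state of order `p + n`, has `b = 0` and keeps the weights (typ-1's `pure_step_of_straight_slot_sigma` at `w = n`, relabelled).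
[OURS] [cite: CossartJannsenSaito2020, Thm. 3.14] -/
theorem pure_step_of_straight_diag_sigma (p : ℕ) {n d : ℕ} (hσ : n + n + d = p) (hn : 0 < n) (hd1 : 1 ≤ d)
    {x y v z : Fin 4} (hxy : x ≠ y) (hxv : x ≠ v) (hxz : x ≠ z) (hyv : y ≠ v) (hyz : y ≠ z) (hvz : v ≠ z) {A : State K}
    (hrA : A.r = Finsupp.single x n + Finsupp.single y n + Finsupp.single v n) (hdivA : ∀ e ∈ A.F.support, A.r ≤ e)
    (ho : ordZero A.F = ((p + n : ℕ) : ℕ∞)) {a : K} (ha : a ≠ 0) (hformA : resForm A = C a * X z ^ d) {jr : Fin 4}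
    (hjz : jr ≠ z) {b : Fin 4 → K} (hbj : b jr = 0)
    (hrA' : ∃ x' y' v' : Fin 4, x' ≠ y' ∧ x' ≠ v' ∧ y' ≠ v' ∧
      (CentreBlowup.step p Finset.univ jr b A).r = Finsupp.single x' n + Finsupp.single y' n + Finsupp.single v' n)
    (ho' : ordZero (CentreBlowup.step p Finset.univ jr b A).F = ((p + n : ℕ) : ℕ∞)) :
    b = 0 ∧ (CentreBlowup.step p Finset.univ jr b A).r = A.r := by
  rcases letters_exhaust hxy hxv hxz hyv hyz hvz jr with h | h | h | h
  · exact SwapTransport.pure_step_of_straight_slot_sigma p hσ hn hn hd1 hxy hxv hxz hyv hyz hvz hrA hdivA ho ha hformA (Or.inl h)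
      hbj hrA' ho'
  · exact SwapTransport.pure_step_of_straight_slot_sigma p hσ hn hn hd1 hxy hxv hxz hyv hyz hvz hrA hdivA ho ha hformA (Or.inr h)
      hbj hrA' ho'
  · have hrA2 : A.r = Finsupp.single v n + Finsupp.single x n + Finsupp.single y n := by
      rw [hrA]; exact (add_rotate _ _ _).symm
    exact SwapTransport.pure_step_of_straight_slot_sigma p hσ hn hn hd1 hxv.symm hyv.symm hvz hxy hxz hyz hrA2 hdivA ho ha hformA
      (Or.inl h) hbj hrA' ho'
  · exact absurd h hjz

/-- **σ-DIAGONAL FRAMED PLAY EXTRACTION, every prime** (typ-1's T2′ `framed_play_slot_sigma` with three chart letters).  A witnessed `Step0 p`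
chain `(c, j, β)` whose charts avoid `z`, clean at `c 0`, `z ∉ exc₀`, with σ-diagonal weights at every time (for SOME three letters), order
`p + n`, `x^r ∣ F₀`, `e_G = 3` and isolation at every time, and any admissible frame datum `φ₀`: the E2-re-framed chain
`s k = T_{φ k} (c k)` is a witnessed play with CONSTANT weights `n·x + n·y + n·v`, order `p + n`, isolation, `e_G = 3`, `x^r ∣ F` at every
time, PURE at every straight time, and the readings of `s 0` off the `p`-th-power lattice are those of `tsch z φ₀ F₀`. [OURS · typ-1's proof,
relabelled] [cite: CossartJannsenSaito2020, Thm. 3.14] [cite: Hauser2010, §§F–G, I] -/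
theorem framed_play_diag_sigma (p : ℕ) [Fact p.Prime] [CharP K p] {n d : ℕ} (hσ : n + n + d = p) (hn : 0 < n) (hd1 : 1 ≤ d)
    {x y v z : Fin 4} (hxy : x ≠ y) (hxv : x ≠ v) (hxz : x ≠ z) (hyv : y ≠ v) (hyz : y ≠ z) (hvz : v ≠ z)
    {c : ℕ → State K} {j : ℕ → Fin 4} {β : ℕ → Fin 4 → K} (hwit : FreeTail.IsWitnessedChain p c j β)
    (hclean : deletePthPowers p (c 0).F = (c 0).F) (hjz : ∀ k, j k ≠ z) (hez : z ∉ (c 0).exc)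
    (hr0 : (c 0).r = Finsupp.single x n + Finsupp.single y n + Finsupp.single v n)
    (hσtail : ∀ k, ∃ x' y' v' : Fin 4, x' ≠ y' ∧ x' ≠ v' ∧ y' ≠ v' ∧
      (c k).r = Finsupp.single x' n + Finsupp.single y' n + Finsupp.single v' n)
    (ho : ∀ k, ordZero (c k).F = ((p + n : ℕ) : ℕ∞)) (hdiv0 : ∀ e ∈ (c 0).F.support, (c 0).r ≤ e)
    (he3 : ∀ k, Module.finrank K (resVertex (c k)) = 3) (hiso : ∀ k, IsIsolated p (c k).F)
    {φ₀ : MvPolynomial (Fin 4) K} (hφ : z ∉ φ₀.vars) (h0 : constantCoeff φ₀ = 0) :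
    ∃ (φ : ℕ → MvPolynomial (Fin 4) K) (b : ℕ → Fin 4 → K) (s : ℕ → State K),
      φ 0 = φ₀ ∧ (∀ k, z ∉ (φ k).vars ∧ constantCoeff (φ k) = 0) ∧
      (∀ k, s k = ⟨deletePthPowers p (FrameChange.tsch z (φ k) (c k).F), (c k).r, (c k).exc⟩) ∧
      FreeTail.IsWitnessedChain p s j b ∧
      (∀ k, (s k).r = Finsupp.single x n + Finsupp.single y n + Finsupp.single v n) ∧
      (∀ k, ordZero (s k).F = ((p + n : ℕ) : ℕ∞)) ∧ (∀ k, IsIsolated p (s k).F) ∧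
      (∀ k, Module.finrank K (resVertex (s k)) = 3) ∧
      (∀ k, ∀ e ∈ (s k).F.support, (s k).r ≤ e) ∧
      (∀ k, (∃ a : K, a ≠ 0 ∧ resForm (s k) = C a * X z ^ d) →
        s (k + 1) = CentreBlowup.step p Finset.univ (j k) 0 (s k)) ∧
      (∀ e : Fin 4 →₀ ℕ, ¬ IsPthPowerExponent p e → coeff e (s 0).F = coeff e (FrameChange.tsch z φ₀ (c 0).F)) := by
  classical
  have hσv := SwapTransport.sigma_weights_values hxy hxv hxz hyv hyz hvz n n
  -- (0) along the REAL chain: weights constant, translations off `z` vanish, `x^r ∣ F`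
  have hstepR : ∀ k, c (k + 1) = CentreBlowup.step p Finset.univ (j k) (β k) (c k) := fun k => (hwit k).2.2.2.2
  have hβj : ∀ k, β k (j k) = 0 := fun k => (hwit k).2.1
  have hrR : ∀ k, (c k).r = Finsupp.single x n + Finsupp.single y n + Finsupp.single v n := by
    intro k
    induction k with
    | zero => exact hr0
    | succ k ih =>
      obtain ⟨x', y', v', h1, h2, h3, hr'⟩ := hσtail (k + 1)
      rw [hstepR k] at hr' ⊢
      exact (step_cases_of_diag_sigma p hn hxy hxv hxz hyv hyz hvz ih (ho k) (hjz k) (hβj k)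
        ⟨x', y', v', h1, h2, h3, hr'⟩).2.trans ih
  have hdivR : ∀ k, ∀ e ∈ (c k).F.support, (c k).r ≤ e := by
    intro k
    induction k with
    | zero => exact hdiv0
    | succ k ih => rw [hstepR k]; exact SwapTransport.forall_le_step_gen (q := p) (c k) ih (j k) (hβj k)
  have hzR : ∀ k, (c k).r z = 0 := fun k => by rw [hrR k]; exact hσv.2.2.2
  -- (1) E2: the re-framed chain
  obtain ⟨φ, b, s, hφ0, hφk, hsk, hwit', -, -, hcarry⟩ :=
    FrameChange.exists_reframed_chain p hwit hclean hjz (hzR 0) hez hφ h0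
  -- (2) carried facts
  have hrs : ∀ k, (s k).r = Finsupp.single x n + Finsupp.single y n + Finsupp.single v n :=
    fun k => (hcarry k).1.trans (hrR k)
  have hos : ∀ k, ordZero (s k).F = ((p + n : ℕ) : ℕ∞) := fun k => (hcarry k).2.2.1.trans (ho k)
  have hisos : ∀ k, IsIsolated p (s k).F := fun k => (hcarry k).2.2.2.2.2.1.mpr (hiso k)
  have hdivs : ∀ k, ∀ e ∈ (s k).F.support, (s k).r ≤ e := fun k => (hcarry k).2.2.2.2.2.2 (hdivR k)
  have hpo : ¬ p ∣ p + n := SwapTransport.not_dvd_add_of_pos_of_lt hn (by omega)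
  have he3s : ∀ k, Module.finrank K (resVertex (s k)) = 3 := by
    intro k
    rw [hsk k, FrameChange.resVertex_cleanTschState_eq p (hφk k).1 (hφk k).2 (ho k) hpo,
      FrameChange.finrank_resVertex_tschState_any (hφk k).2 (hφk k).1
        (c := fun i => if i = z then 0 else coeff (Finsupp.single i 1) (φ k)) (if_pos rfl)
        (fun i hi => by rw [if_neg hi]) (hzR k) (hdivR k)]
    exact he3 k
  -- (3) purity at every straight time
  have hpure : ∀ k, (∃ a : K, a ≠ 0 ∧ resForm (s k) = C a * X z ^ d) →
      s (k + 1) = CentreBlowup.step p Finset.univ (j k) 0 (s k) := by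
    rintro k ⟨a, ha, hform⟩
    have hst : s (k + 1) = CentreBlowup.step p Finset.univ (j k) (b k) (s k) := (hwit' k).2.2.2.2
    have hbj : b k (j k) = 0 := (hwit' k).2.1
    have hb0 : b k = 0 := by
      refine (pure_step_of_straight_diag_sigma p hσ hn hd1 hxy hxv hxz hyv hyz hvz (hrs k) (hdivs k) (hos k) ha hform
        (hjz k) hbj ⟨x, y, v, hxy, hxv, hyv, ?_⟩ ?_).1
      · rw [← hst]; exact hrs (k + 1)
      · rw [← hst]; exact hos (k + 1)
    rw [hst, hb0]
  -- (4) the entry readings survive the cleaning off the `p`-th-power lattice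
  have hread0 : ∀ e : Fin 4 →₀ ℕ, ¬ IsPthPowerExponent p e →
      coeff e (s 0).F = coeff e (FrameChange.tsch z φ₀ (c 0).F) := by
    intro e he
    rw [hsk 0, hφ0, coeff_deletePthPowers, if_neg he]
  exact ⟨φ, b, s, hφ0, hφk, hsk, hwit', hrs, hos, hisos, he3s, hdivs, hpure, hread0⟩

/-! ## §3 The kill in T-normal form: no σ-diagonal three-letter power-cone tail from a letter change -/

/-- **NO σ-DIAGONAL THREE-LETTER POWER-CONE TAIL IN T-NORMAL FORM FROM A LETTER CHANGE, every prime, every `n ≥ 1` with `2n + d = p`,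
`d ≥ 2`** (composition: res-dim4-p-1 g6's entry frame `twoSlot_entry_frame_sigma` (Tschirnhaus order `N = 2`) ∘ `framed_play_diag_sigma` ∘
`core_play_diag_sigma` (the framed chain is pure-corner AT EVERY TIME) ∘ re-witnessing with zero translations ∘ res-dim4-p-5 g6's
`no_pureCorner_tail`).  The charts are only assumed to avoid the carrier `z` (rotation through all three weighted letters allowed); no slot
ledger, no game, no `w ≠ n`. [OURS · composition] [cite: CossartJannsenSaito2020, Thm. 3.14] -/
theorem no_threeLetter_powerCone_tail_diag_sigma (p : ℕ) [Fact p.Prime] [CharP K p] {n d : ℕ} (hσ : n + n + d = p) (hn : 0 < n)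
    (hd2 : 2 ≤ d) {x y v z : Fin 4} (hxy : x ≠ y) (hxv : x ≠ v) (hxz : x ≠ z) (hyv : y ≠ v) (hyz : y ≠ z) (hvz : v ≠ z)
    {c : ℕ → State K} {j : ℕ → Fin 4} {β : ℕ → Fin 4 → K} (hwit : FreeTail.IsWitnessedChain p c j β)
    (hclean : deletePthPowers p (c 0).F = (c 0).F) (hjz : ∀ k, j k ≠ z) (hez : z ∉ (c 0).exc)
    (hr0 : (c 0).r = Finsupp.single x n + Finsupp.single y n + Finsupp.single v n)
    (hσtail : ∀ k, ∃ x' y' v' : Fin 4, x' ≠ y' ∧ x' ≠ v' ∧ y' ≠ v' ∧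
      (c k).r = Finsupp.single x' n + Finsupp.single y' n + Finsupp.single v' n)
    (ho : ∀ k, ordZero (c k).F = ((p + n : ℕ) : ℕ∞)) (hdiv0 : ∀ e ∈ (c 0).F.support, (c 0).r ≤ e)
    (he3 : ∀ k, Module.finrank K (resVertex (c k)) = 3) (hiso : ∀ k, IsIsolated p (c k).F)
    {a₀ : K} {ℓ : Fin 4 → K} (ha₀ : a₀ ≠ 0) (hℓz : ℓ z ≠ 0)
    (hform : resForm (c 0) = C a₀ * (∑ i, C (ℓ i) * X i) ^ d) (hchange : j 0 ≠ j 1) : False := by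
  classical
  have hp : p.Prime := Fact.out
  have hdK : (d : K) ≠ 0 := fun h => by
    have hdvd := (CharP.cast_eq_zero_iff K p d).mp h
    have := Nat.le_of_dvd (by omega) hdvd
    omega
  have hrdeg : (c 0).r.degree = 2 * n + n := by
    rw [hr0, map_add, map_add, Finsupp.degree_single, Finsupp.degree_single, Finsupp.degree_single]; ring
  have hrz : (c 0).r z = 0 := by rw [hr0]; simp [hxz.symm, hyz.symm, hvz.symm]
  have hrx : (c 0).r x = n := by rw [hr0]; simp [hxy, hxv]
  -- (1) ENTRY: p-1 g6's straight Tschirnhaus frame at time 0, order N = 2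
  obtain ⟨φ₀, h0, hφ, htschF, -, hcoef, hne, hstr, hjet, -, -, -⟩ :=
    FrameChange.twoSlot_entry_frame_sigma (f := z) p (s := c 0) (o := p + n) (d := d) (by omega) hdK (ho 0) hdiv0
      (by rw [hrdeg]; omega) hrz ha₀ hℓz hform 2
  -- (2) TRANSPORT: the framed play, diagonal edition
  obtain ⟨φ, b, s, -, -, -, -, hrS, hoS, hisoS, he3S, hdivS, hpure, hcoeff0⟩ :=
    framed_play_diag_sigma p hσ hn (by omega) hxy hxv hxz hyv hyz hvz hwit hclean hjz hez hr0 hσtail ho hdiv0 he3 hiso hφ h0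
  -- readings of the framed start, off the `p`-th-power lattice
  have hr0S : (s 0).r = (c 0).r := by rw [hrS 0, hr0]
  have hread : ∀ m : Fin 4 →₀ ℕ, m x + n + 1 ≤ p →
      coeff ((s 0).r + m) (s 0).F = coeff m (FrameChange.tsch z φ₀ ((c 0).F.divMonomial (c 0).r)) := by
    intro m hmx
    have hnp : ¬ IsPthPowerExponent p ((s 0).r + m) := not_isPthPowerExponent_of_not_dvd (i := x) (by
      rw [Finsupp.add_apply, hr0S, hrx]
      intro hdvd
      have := Nat.le_of_dvd (by omega) hdvd
      omega)
    rw [hcoeff0 _ hnp, hr0S, htschF, coeff_monomial_mul', if_pos le_self_add, one_mul, add_tsub_cancel_left]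
  -- the chart word lives on the three weighted letters
  have hκ : ∀ k, j k = x ∨ j k = y ∨ j k = v := fun k => by
    rcases letters_exhaust hxy hxv hxz hyv hyz hvz (j k) with h | h | h | h
    · exact Or.inl h
    · exact Or.inr (Or.inl h)
    · exact Or.inr (Or.inr h)
    · exact absurd h (hjz k)
  -- (3) CORE: the ledger-free package along the framed play ⇒ pure at EVERY time
  have ha0 : coeff ((s 0).r + Finsupp.single z d) (s 0).F ≠ 0 := by
    rw [hread _ (by simp [hxz.symm]; omega), hcoef]; exact hne
  have hstraight0 : ∀ m : Fin 4 →₀ ℕ, m.degree = d → m ≠ Finsupp.single z d → coeff ((s 0).r + m) (s 0).F = 0 := by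
    intro m hm hmne
    have hmx : m x ≤ d := by
      have := Finsupp.le_degree x m
      omega
    rw [hread _ (by omega)]
    exact hstr m hm hmne
  have htsch0 : coeff ((s 0).r + (Finsupp.single z (d - 1) + Finsupp.single (j 0) 2)) (s 0).F = 0 := by
    have hmx : (Finsupp.single z (d - 1) + Finsupp.single (j 0) 2 : Fin 4 →₀ ℕ) x ≤ 2 := by
      simp only [Finsupp.add_apply, Finsupp.single_apply, if_neg (Ne.symm hxz)]
      split_ifs <;> omega
    rw [hread _ (by omega)]
    refine hjet _ ?_ ?_
    · rw [Finsupp.add_apply, Finsupp.single_eq_same, Finsupp.single_apply, if_neg (hjz 0), add_zero]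
    · rw [map_add, Finsupp.degree_single, Finsupp.degree_single]; omega
  have core := core_play_diag_sigma hxy hxv hxz hyv hyz hvz p hσ hn hd2 s j hκ hpure (hrS 0) (hdivS 0) hoS he3S ha0 hstraight0
    htsch0 hchange
  have hpureAll : ∀ k, s (k + 1) = CentreBlowup.step p Finset.univ (j k) 0 (s k) := fun k => (core k).2.2.2.2.2
  -- (4) RE-WITNESS with zero translations and finish with p-5's drift theorem
  have hwit0 : FreeTail.IsWitnessedChain p s j (fun _ => 0) := by
    intro k
    have hq : ((p : ℕ) : ℕ∞) ≤ ordAlong Finset.univ (s k).F := by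
      rw [ordAlong_univ, hoS k]; exact_mod_cast (by omega : p ≤ p + n)
    refine ⟨hq, rfl, ?_, ?_, hpureAll k⟩
    · rw [Equimultiple.isEquimultiplePoint_iff_le_ordZero_step, ← hpureAll k, hoS (k + 1)]
      exact_mod_cast (by omega : p ≤ p + n)
    · rw [← hpureAll k]
      intro hF
      have h := hoS (k + 1)
      rw [hF, ordZero_zero] at h
      exact ENat.top_ne_coe _ h
  exact no_pureCorner_tail p (fun k => ⟨hisoS k, FrameChange.step0_of_isWitnessedChain hwit0 k⟩) hwit0 (k₀ := 0)
    (fun k _ => rfl)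

end ResCone
end Summit.ResolutionOfSingularities.ResolutionOfSingularities.Theorems.PIDim4

end
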